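import Summits.RiemannHypothesis.RiemannHypothesis.Theorems.HandoffThinRigidity
import Summits.RiemannHypothesis.RiemannHypothesis.Theorems.SoloInformedGroundStateTracking
import Literature.NumberTheory.LFunctions.WeilGroundStateRealZerosProofs
import HarnessLib

/-!
# Thin ⟹ RH for the Weil ground states themselves: the programme form on one disc (file XVIII-c)

Handoff track (ROUTE 1′), seat handoff-theory-1 gen16; continuation of files XVIII-a
`HandoffEvenRealZerosGrowth` (p387006) and XVIII-b `HandoffThinRigidity` (p387345), which prove
the Laguerre–Pólya rigidity for ABSTRACT families (even entire functions of order `< 2` with only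
real zeros: convergence to `Ξ` on one disc ⟹ locally uniform convergence on `ℂ` ⟹ RH). This file
says it in the tree's own vocabulary for the WEIL GROUND STATES, i.e. for the objects of idea-3
gen22's route R-K and of the route `Theses/WeilGroundState.lean`:

* `riemannHypothesis_of_weilGroundStates_disc` — let `a n` be windows with simple, even bottoms
  (`WeilWindowSimpleEven (a n)` = the window clause of the crux `GroundStateSimpleEven`,
  stmt-RiemannHypothesis-1526), `u n` EVEN ground states there (`IsWeilGroundState`, operator-free),
  `c n ≠ 0`; if `z ↦ c n · û_n(1/2 + i z)` converges to `Ξ = riemannXiUpper` uniformly on SOME disc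
  `closedBall 0 A`, then `RiemannHypothesis`. This is the DISC version of
  `SoloInformedGroundStateLimit.riemannHypothesis_of_weilGroundStates` (there: locally uniformly on
  the whole strip `|Im z| < 1/2`), with the Connes–van Suijlekom fact DISCHARGED by the tree's
  `Connes2026_weilGroundState_zeros_re_eq_half_holds` (all zeros of `û_n` real) and the growth input
  `norm_weilMellin_le_of_ae_vanish` (`û_n` is of exponential type `a n`).
* helpers: `exists_order_lt_two_of_exp_type` (exponential type ⟹ the order-`3/2` growth form used
  by XVIII-a/b), `weilMellin_half_add_I_mul_neg` (evenness of `z ↦ û(1/2 + iz)` for even `u`).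

PLACEMENT (HANDOFF-STATEMENT §J.31, LOGIC-CARD 4‴): idea-3's SC-3 «thin convergence», asked of the
simple even ground states, is therefore `≥ RH` ALONE — the count law SC-2 of route R-K is idle —
and the tree's crux `GroundStatesConvergeToXi` (stmt-1527) may be asked on one disc. The
hypotheses are conjectural; nothing here bears on the truth of RH.
-/

set_option linter.dupNamespace false

noncomputable section

open Filter Set Topology Metric Complex
open scoped ComplexConjugate Real

namespace Summit.RiemannHypothesis.RiemannHypothesis.Theorems

namespace ThinRigidity

/-! ## §4 The programme form on one disc (Weil ground states, fact discharged) -/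

section GroundStates

open Literature.NumberTheory.LFunctions

/-- Exponential type ⟹ the `‖F z‖ ≤ C exp(‖z‖^ρ)`, `ρ < 2`, growth form (with `ρ = 3/2`):
`c‖z‖ ≤ c³ + ‖z‖^{3/2}` for `c ≥ 0`. -/
theorem exists_order_lt_two_of_exp_type {F : ℂ → ℂ} {K c : ℝ} (hK : 0 ≤ K) (hc : 0 ≤ c)
    (h : ∀ z, ‖F z‖ ≤ K * Real.exp (c * ‖z‖)) :
    ∃ ρ C : ℝ, 0 ≤ ρ ∧ ρ < 2 ∧ ∀ z, ‖F z‖ ≤ C * Real.exp (‖z‖ ^ ρ) := by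
  refine ⟨3 / 2, K * Real.exp (c ^ 3), by norm_num, by norm_num, fun z => ?_⟩
  have key : c * ‖z‖ ≤ c ^ 3 + ‖z‖ ^ (3 / 2 : ℝ) := by
    have h2 : 0 ≤ ‖z‖ ^ (3 / 2 : ℝ) := Real.rpow_nonneg (norm_nonneg _) _
    rcases le_or_gt ‖z‖ (c ^ 2) with h1 | h1
    · have : c * ‖z‖ ≤ c * c ^ 2 := mul_le_mul_of_nonneg_left h1 hc
      nlinarith
    · have hzpos : 0 < ‖z‖ := lt_of_le_of_lt (sq_nonneg c) h1
      have hsqrt : c ≤ Real.sqrt ‖z‖ := by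
        rw [← Real.sqrt_sq hc]; exact Real.sqrt_le_sqrt h1.le
      have h3 : ‖z‖ ^ (3 / 2 : ℝ) = ‖z‖ * Real.sqrt ‖z‖ := by
        rw [show (3 / 2 : ℝ) = 1 + 1 / 2 by norm_num, Real.rpow_add hzpos, Real.rpow_one,
          Real.sqrt_eq_rpow]
      rw [h3]
      have : c * ‖z‖ ≤ Real.sqrt ‖z‖ * ‖z‖ := mul_le_mul_of_nonneg_right hsqrt (norm_nonneg _)
      have h4 : 0 ≤ c ^ 3 := pow_nonneg hc 3
      nlinarith
  calc ‖F z‖ ≤ K * Real.exp (c * ‖z‖) := h z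
    _ ≤ K * Real.exp (c ^ 3 + ‖z‖ ^ (3 / 2 : ℝ)) := by gcongr
    _ = K * Real.exp (c ^ 3) * Real.exp (‖z‖ ^ (3 / 2 : ℝ)) := by rw [Real.exp_add]; ring

/-- Evenness of the transform of an even function in the `z`-variable: `û(1/2 + i(−z)) = û(1/2 + iz)`
(substitute `t ↦ −t`; no integrability needed). -/
theorem weilMellin_half_add_I_mul_neg {u : ℝ → ℂ} (hev : ∀ t : ℝ, u (-t) = u t) (z : ℂ) :
    weilMellin u (1 / 2 + I * -z) = weilMellin u (1 / 2 + I * z) := by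
  unfold weilMellin
  have h := MeasureTheory.integral_neg_eq_self
    (fun t : ℝ ↦ u (-t) * cexp ((1 / 2 + I * -z - 1 / 2) * ((-t : ℝ) : ℂ))) MeasureTheory.volume
  simp only [neg_neg] at h
  rw [h]
  congr 1 with t
  rw [hev t]
  congr 1
  push_cast
  ring

/-- **The programme form on ONE DISC** (disc version of
`SoloInformedGroundStateLimit.riemannHypothesis_of_weilGroundStates`, with the Connes–van Suijlekom
fact DISCHARGED by the tree's `Connes2026_weilGroundState_zeros_re_eq_half_holds`). Let `a n` be
windows with simple even bottoms (`WeilWindowSimpleEven`), `u n` even ground states there, `c n ≠ 0`,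
and suppose the normalised transforms `z ↦ c n · û_n(1/2 + iz)` converge to `Ξ` uniformly on SOME
disc `closedBall 0 A`, `A > 0`. Then the Riemann Hypothesis holds — (M2) «on the strip» may be
asked on one disc. Conjectural hypotheses; nothing here bears on the truth of RH. -/
theorem riemannHypothesis_of_weilGroundStates_disc (a : ℕ → ℝ) (u : ℕ → ℝ → ℂ) (c : ℕ → ℂ)
    (hM1 : ∀ n, WeilWindowSimpleEven (a n)) (hu : ∀ n, IsWeilGroundState (a n) (u n))
    (hev : ∀ n t, u n (-t) = u n t) (hc : ∀ n, c n ≠ 0) {A : ℝ} (hA : 0 < A)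
    (hM2 : TendstoUniformlyOn (fun n z ↦ c n * weilMellin (u n) (1 / 2 + I * z)) riemannXiUpper
      atTop (closedBall 0 A)) :
    RiemannHypothesis := by
  refine riemannHypothesis_of_even_realZeros_of_tendstoUniformlyOn
    (F := fun n z ↦ c n * weilMellin (u n) (1 / 2 + I * z)) ?_ ?_ ?_ ?_ hA hM2
  · intro n
    exact (differentiable_const _).mul ((hu n).differentiable_weilMellin.comp
      ((differentiable_const _).add ((differentiable_const _).mul differentiable_id)))
  · intro n
    have h0 : 0 ≤ a n := (hu n).pos.le
    set K : ℝ := ‖c n‖ * (Real.sqrt (2 * a n) * Real.sqrt (∫ t, ‖u n t‖ ^ 2)) with hK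
    refine exists_order_lt_two_of_exp_type (K := K) (c := a n) (by positivity) h0 fun z => ?_
    have hb := norm_weilMellin_le_of_ae_vanish h0 (hu n).memLp (hu n).ae_eq_zero_of_notMem z
    have him : |z.im| * a n ≤ a n * ‖z‖ := by
      rw [mul_comm]; exact mul_le_mul_of_nonneg_left (Complex.abs_im_le_norm z) h0
    calc ‖c n * weilMellin (u n) (1 / 2 + I * z)‖
        = ‖c n‖ * ‖weilMellin (u n) (1 / 2 + I * z)‖ := norm_mul _ _
      _ ≤ ‖c n‖ * (Real.exp (|z.im| * a n) *
            (Real.sqrt (2 * a n) * Real.sqrt (∫ t, ‖u n t‖ ^ 2))) := by gcongr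
      _ ≤ ‖c n‖ * (Real.exp (a n * ‖z‖) *
            (Real.sqrt (2 * a n) * Real.sqrt (∫ t, ‖u n t‖ ^ 2))) := by gcongr
      _ = K * Real.exp (a n * ‖z‖) := by rw [hK]; ring
  · intro n z
    show c n * weilMellin (u n) (1 / 2 + I * -z) = c n * weilMellin (u n) (1 / 2 + I * z)
    rw [weilMellin_half_add_I_mul_neg (hev n)]
  · intro n z hz
    rcases mul_eq_zero.1 hz with h | h
    · exact absurd h (hc n)
    · exact Connes2026_weilGroundState_zeros_re_eq_half.im_eq_zero_of_fourier_eq_zero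
        Connes2026_weilGroundState_zeros_re_eq_half_holds (hM1 n) (hu n) h

end GroundStates

end ThinRigidity

end Summit.RiemannHypothesis.RiemannHypothesis.Theorems
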